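import Literature.Computability.AlgebraicComplexity.OrbitClosureProofs
import Literature.Computability.AlgebraicComplexity.DeterminantalComplexityProofs
import HarnessLib

/-!
# Padded power sums lie in the orbit closure of the determinant (BIP 2019, Thm. 2.5)

Bürgisser–Ikenmeyer–Panova, *No occurrence obstructions in geometric complexity theory*,
J. AMS 32 (2019) = arXiv:1604.06431v3, Thm. 2.5: "Let `X, φ_1, …, φ_k` be linear forms on
`ℂ^{n×n}` and assume `n ≥ sk`. Then the power sum `X^{n-s} (φ_1^s + ⋯ + φ_k^s)` of `k` terms of
degree `s`, padded to degree `n`, is contained in `Ω_n`" (`Ω_n = \overline{GL_{n²} · det_n}`).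
BIP: "we exploit very little information on the orbit closure `Ω_n` of the determinant. The
only property we use is that `Ω_n` contains many padded power sums."

This file proves the statement over any infinite field
(`X_pow_mul_sum_pow_mem_orbitClosure_detPoly`), following the printed proof: the power sum
`X_1^s + ⋯ + X_k^s` has an affine determinantal representation of size `n`
(`hasDetRepr_sum_X_pow`, file `DeterminantalComplexityProofs.lean`, replacing the appeal to
Valiant's formula construction by an explicit matrix); homogenising its entries with the linear
form `X` and substituting the linear forms `φ_i` for the variables gives an `n × n` matrix of
linear forms whose determinant is `X^{n-s} (φ_1^s + ⋯ + φ_k^s)`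
(`X_pow_mul_aeval_mem_endOrbit_detPoly`, the linear-form version of
`X_pow_mul_rename_mem_endOrbit_detPoly` of `OrbitClosureProofs.lean`), and the determinant of any
matrix of linear forms in the `n²` variables is a linear substitution instance of `det_n`
(`det_mem_endOrbit_detPoly`), hence lies in `End · det_n ⊆ Ω_n`
(`endOrbit_subset_orbitClosure_holds`). The degenerate cases `X = 0` and `k = 0` (where the
padded power sum is `0` or `φ_1^n`) are treated directly.

## Sources

* P. Bürgisser, C. Ikenmeyer, G. Panova, J. AMS 32 (2019) = arXiv:1604.06431v3, Thm. 2.5 and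
  its proof (key `BurgisserIkenmeyerPanovaJAMS2019`).
* K. Mulmuley, M. Sohoni, *Geometric complexity theory I*, SIAM J. Comput. 31 (2001), §4
  (`End · f ⊆ Δ[f]`) (key `MulmuleySohoniSIAM2001`).
-/

noncomputable section

open MvPolynomial

namespace Literature.Computability.AlgebraicComplexity

variable {k : Type*} [Field k] {σ : Type*} [Fintype σ]

/-- A linear form is the sum of its coefficients times the variables:
`f = ∑_p coeff_{e_p}(f) X_p` for `f` homogeneous of degree `1`. [folklore] -/
theorem sum_coeff_single_smul_X {f : MvPolynomial σ k} (hf : f.IsHomogeneous 1) :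
    ∑ p, coeff (Finsupp.single p 1) f • (X p : MvPolynomial σ k) = f := by
  classical
  ext d
  simp only [coeff_sum, coeff_smul, coeff_X, smul_eq_mul, mul_ite, mul_one, mul_zero]
  by_cases hd : ∃ p, Finsupp.single p 1 = d
  · obtain ⟨p, rfl⟩ := hd
    rw [Finset.sum_eq_single p (fun q _ hq => if_neg fun h =>
      hq (Finsupp.single_left_injective one_ne_zero h)) (fun h => absurd (Finset.mem_univ p) h),
      if_pos rfl]
  · rw [Finset.sum_eq_zero fun p _ => if_neg fun h => hd ⟨p, h⟩]
    refine (hf.coeff_eq_zero fun hdeg => hd ?_).symm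
    obtain ⟨p, hp⟩ := (Finsupp.sum_eq_one_iff d).mp hdeg
    exact ⟨p, hp.symm⟩

/-- **The determinant of a matrix of linear forms in the `m²` variables is a linear substitution
instance of `det_m`**: `det N = M · det_m ∈ End · det_m` for the matrix `M` whose column `(i,j)`
is the coefficient vector of the linear form `N i j`. Mulmuley–Sohoni 2001 §4;
Bürgisser–Ikenmeyer–Panova 2019, proof of Thm. 2.5 ("the determinant of an `n × n`-matrix with
homogeneous linear entries ... lies in `Ω_n`"). [cite: BurgisserIkenmeyerPanovaJAMS2019, Thm. 2.5] -/
theorem det_mem_endOrbit_detPoly {m : ℕ}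
    (N : Matrix (Fin m) (Fin m) (MvPolynomial (Fin m × Fin m) k))
    (hN : ∀ i j, (N i j).IsHomogeneous 1) :
    N.det ∈ endOrbit (Fin m × Fin m) k (detPoly (Fin m) k) := by
  classical
  refine ⟨fun p ij => coeff (Finsupp.single p 1) (N ij.1 ij.2), ?_⟩
  dsimp only
  rw [detPoly, AlgHom.map_det, AlgHom.mapMatrix_apply]
  refine congrArg Matrix.det (Matrix.ext fun i j => ?_)
  rw [Matrix.map_apply, Matrix.mvPolynomialX_apply, linSubst_X]
  exact sum_coeff_single_smul_X (hN i j)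

/-- **Homogenised determinantal representations, linear-form version.** If a form `q` of degree
`s ≤ m` in variables `τ` has an affine determinantal representation of size `m`, then for every
nonzero linear form `ℓ` and linear forms `φ_t` on `k^{m×m}`, the padded substitution instance
`ℓ^{m-s} · q(φ)` is a linear substitution instance of `det_m`: homogenise the affine entries with
`ℓ` (`a₀ + ∑ a_t x_t ↦ a₀ ℓ + ∑ a_t φ_t`); the resulting matrix of linear forms has determinant
`ℓ^{m-s} q(φ)` (compare values wherever `ℓ ≠ 0`, pulling `ℓ` out of every row and using the
homogeneity of `q`; `k` infinite), and `det_mem_endOrbit_detPoly` applies.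
Bürgisser–Ikenmeyer–Panova 2019, proof of Thm. 2.5 ("By substituting `X_i` with `X_i / X_{k+1}`
and multiplying with `X_{k+1}^n` ... applying a linear map sending `X_{k+1}` to `X` and `X_i` to
`φ_i`"); Mulmuley–Sohoni 2001, Prop. 4.4. [cite: BurgisserIkenmeyerPanovaJAMS2019, Thm. 2.5] -/
theorem X_pow_mul_aeval_mem_endOrbit_detPoly [Infinite k] {τ : Type*} [Fintype τ]
    [DecidableEq τ] {q : MvPolynomial τ k} {s m : ℕ} (hq : q.IsHomogeneous s) (hsm : s ≤ m)
    (hA : HasDetRepr q m) {ℓ : MvPolynomial (Fin m × Fin m) k} (hℓ : ℓ.IsHomogeneous 1)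
    (hℓ0 : ℓ ≠ 0) (φ : τ → MvPolynomial (Fin m × Fin m) k) (hφ : ∀ t, (φ t).IsHomogeneous 1) :
    ℓ ^ (m - s) * aeval φ q ∈ endOrbit (Fin m × Fin m) k (detPoly (Fin m) k) := by
  classical
  obtain ⟨A, hAdeg, hAdet⟩ := hA
  -- the homogenised matrix of linear forms
  set N : Matrix (Fin m) (Fin m) (MvPolynomial (Fin m × Fin m) k) := fun i j =>
    C (coeff 0 (A i j)) * ℓ + ∑ t, C (coeff (Finsupp.single t 1) (A i j)) * φ t with hN
  have hNhom : ∀ i j, (N i j).IsHomogeneous 1 := fun i j =>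
    (hℓ.C_mul _).add (IsHomogeneous.sum _ _ _ fun t _ => (hφ t).C_mul _)
  -- values of the entries where `ℓ(x) ≠ 0`
  have hentry : ∀ (x : Fin m × Fin m → k), eval x ℓ ≠ 0 → ∀ i j : Fin m,
      eval x (N i j) = eval x ℓ * eval (fun t => eval x (φ t) / eval x ℓ) (A i j) := by
    intro x hx i j
    rw [eval_eq_of_totalDegree_le_one (hAdeg i j)]
    simp only [hN, map_add, map_sum, map_mul, eval_C]
    rw [mul_add, Finset.mul_sum]
    congr 1
    · ring
    · refine Finset.sum_congr rfl fun t _ => ?_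
      field_simp
  -- values of the determinant where `ℓ(x) ≠ 0`
  have hdet : ∀ (x : Fin m × Fin m → k), eval x ℓ ≠ 0 →
      eval x N.det = eval x ℓ ^ (m - s) * eval x (aeval φ q) := by
    intro x hx
    have hmat : N.map (eval x) = eval x ℓ • A.map (eval fun t => eval x (φ t) / eval x ℓ) := by
      ext i j
      simp only [Matrix.map_apply, Matrix.smul_apply, smul_eq_mul]
      exact hentry x hx i j
    have haeval : eval x (aeval φ q) = eval (fun t => eval x (φ t)) q := by
      change aeval x (aeval φ q) = aeval (fun t => eval x (φ t)) q
      rw [← AlgHom.comp_apply, comp_aeval]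
      rfl
    rw [RingHom.map_det, RingHom.mapMatrix_apply, hmat, Matrix.det_smul, Fintype.card_fin,
      ← RingHom.mapMatrix_apply, ← RingHom.map_det, hAdet, haeval]
    have hscale : (fun t => eval x (φ t) / eval x ℓ) = (eval x ℓ)⁻¹ • fun t => eval x (φ t) := by
      funext t
      simp [div_eq_inv_mul]
    have hpow : ∀ a : k, a ≠ 0 → a ^ m * a⁻¹ ^ s = a ^ (m - s) := fun a ha => by
      rw [← Nat.sub_add_cancel hsm, pow_add, Nat.add_sub_cancel, mul_assoc, ← mul_pow,
        mul_inv_cancel₀ ha, one_pow, mul_one]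
    rw [hscale, eval_smul_of_isHomogeneous hq, ← mul_assoc, hpow _ hx]
  -- the two polynomials agree where `ℓ(x) ≠ 0`, hence everywhere
  have hprod : (N.det - ℓ ^ (m - s) * aeval φ q) * ℓ = 0 := by
    apply MvPolynomial.funext
    intro x
    rw [map_mul, map_sub, map_zero]
    by_cases hx : eval x ℓ = 0
    · rw [hx, mul_zero]
    · rw [hdet x hx, map_mul, map_pow, sub_self, zero_mul]
  have hEq : N.det = ℓ ^ (m - s) * aeval φ q :=
    sub_eq_zero.mp ((mul_eq_zero.mp hprod).resolve_right hℓ0)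
  exact hEq ▸ det_mem_endOrbit_detPoly N hNhom

/-- **Padded power sums lie in `Ω_m` (Bürgisser–Ikenmeyer–Panova 2019, Thm. 2.5), over any
infinite field.** For linear forms `ℓ, φ_0, …, φ_{k-1}` on `k^{m×m}` (`m ≥ 1`) and `s k ≤ m`,
`ℓ^{m-s} (φ_0^s + ⋯ + φ_{k-1}^s) ∈ \overline{GL_{m²} · det_m}` — indeed it lies in `End · det_m`.
Main case (`ℓ ≠ 0`, `k ≥ 1`, so `s ≤ m`): `X_pow_mul_aeval_mem_endOrbit_detPoly` for the power sum
`q = ∑ X_i^s`, which has an affine determinantal representation of size `m`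
(`hasDetRepr_sum_X_pow`); degenerate cases: for `k = 0`, or `ℓ = 0` and `s < m`, the polynomial
is `0 = det 0`; for `ℓ = 0`, `s ≥ m`, `k ≥ 1` one has `s = m`, `k = 1` and the polynomial is
`φ_0^m = det (diag φ_0)`. [cite: BurgisserIkenmeyerPanovaJAMS2019, Thm. 2.5] -/
theorem X_pow_mul_sum_pow_mem_orbitClosure_detPoly [Infinite k] {m s kk : ℕ} [NeZero m]
    (h : s * kk ≤ m) {ℓ : MvPolynomial (Fin m × Fin m) k} (hℓ : ℓ.IsHomogeneous 1)
    (φ : Fin kk → MvPolynomial (Fin m × Fin m) k) (hφ : ∀ i, (φ i).IsHomogeneous 1) :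
    ℓ ^ (m - s) * ∑ i, φ i ^ s ∈ orbitClosure (detPoly (Fin m) k) := by
  classical
  refine endOrbit_subset_orbitClosure_holds _ ?_
  have hm1 : 1 ≤ m := Nat.pos_of_ne_zero (NeZero.ne m)
  haveI : Nonempty (Fin m) := ⟨⟨0, hm1⟩⟩
  -- `0 ∈ End · det_m`
  have hzero : (0 : MvPolynomial (Fin m × Fin m) k) ∈
      endOrbit (Fin m × Fin m) k (detPoly (Fin m) k) := by
    have := det_mem_endOrbit_detPoly (0 : Matrix (Fin m) (Fin m) (MvPolynomial (Fin m × Fin m) k))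
      fun _ _ => isHomogeneous_zero _ _ _
    rwa [Matrix.det_zero] at this
  rcases Nat.eq_zero_or_pos kk with rfl | hkk
  · -- no terms
    simpa using hzero
  have hsm : s ≤ m := le_trans (Nat.le_mul_of_pos_right s hkk) h
  by_cases hℓ0 : ℓ = 0
  · subst hℓ0
    rcases Nat.lt_or_ge s m with hlt | hge
    · rw [zero_pow (Nat.sub_ne_zero_of_lt hlt), zero_mul]
      exact hzero
    · -- `s = m`, `kk = 1`: the polynomial is `φ 0 ^ m = det (diag (φ 0))`
      have hs : s = m := le_antisymm hsm hge
      subst hs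
      have hk1 : kk = 1 := by
        refine le_antisymm ?_ hkk
        by_contra hk
        have : s * 2 ≤ s * kk := Nat.mul_le_mul_left s (by omega)
        omega
      subst hk1
      rw [Nat.sub_self, pow_zero, one_mul, Fin.sum_univ_one]
      have := det_mem_endOrbit_detPoly (Matrix.diagonal fun _ : Fin s => φ 0) fun i j => by
        rw [Matrix.diagonal_apply]
        split_ifs
        · exact hφ 0
        · exact isHomogeneous_zero _ _ _
      rwa [Matrix.det_diagonal, Finset.prod_const, Finset.card_univ, Fintype.card_fin] at this
  · -- main case
    have hq : (∑ i : Fin kk, (X i : MvPolynomial (Fin kk) k) ^ s).IsHomogeneous s :=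
      IsHomogeneous.sum _ _ _ fun i _ => isHomogeneous_X_pow i s
    have hmem := X_pow_mul_aeval_mem_endOrbit_detPoly hq hsm (hasDetRepr_sum_X_pow s kk m h hm1)
      hℓ hℓ0 φ hφ
    simpa only [map_sum, map_pow, aeval_X] using hmem

end Literature.Computability.AlgebraicComplexity
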